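import Summits.SmoothPoincare4.SmoothPoincare4.Theses.EntropyRung
import Summits.SmoothPoincare4.SmoothPoincare4.Theorems.EntropyRungNoncompactShrinkerGapStubThreeShrinkerGap
import Literature.Geometry.Riemannian.ThreeShrinkerCompactDegenerate
import Literature.Geometry.Riemannian.ThreeShrinkerScalarFlatCase
import Literature.Geometry.Riemannian.ShrinkerScalarCurvatureNonnegHolds
import Literature.Geometry.Riemannian.ThreeShrinkerClassificationHolds
import HarnessLib

/-!
# `EntropyRung.ThreeShrinkerGap` (stmt-SmoothPoincare4-16586) — reduced to the complete
# non-compact shrinkers of positive scalar curvature, and closed modulo the classification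

The support item `ThreeShrinkerGap` of route `SmoothPoincare4/EntropyRung` ("the rung one dimension
down"): every complete connected non-flat normalised three-dimensional gradient shrinking Ricci
soliton `(N, h, φ)` (`Ric + Hess φ = h/2`, `R + |∇φ|² = φ`, `R ≢ 0`; compact allowed) has
`∫_N e^{-φ} dV_h ≤ 16π² e^{-3/2} = (4π)^{3/2} Θ₃(S³)`.

What this file proves, from theorems of the tree only (no named fact enters except where said):

* `weightedVolume_le_of_modelData` — the four-way model-data disjunction of
  `threeShrinkerClassification_modelData` FOR ONE SOLITON, together with `R ≢ 0`, gives the bound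
  (case analysis of p87530, with its three arithmetic lemmas `e ≤ π`, `|Γ| ≥ 1`).
* `weightedVolume_le_of_compactSpace` — the COMPACT case of the item is a theorem of the tree:
  `ThreeShrinker.modelData_of_compactSpace` (Ivey / Eminenti–La Nave–Mantegazza, landed) feeds the
  previous lemma.
* `weightedVolume_le_of_exists_scalarCurvature_nonpos` — a complete member with a point where
  `R ≤ 0` is the Gaussian soliton (Zhang–Chen `R ≥ 0`, DISCHARGED in the tree as
  `shrinkerScalarCurvature_nonneg_holds`, and `ThreeShrinker.scalarCurvature_pos_or_modelData`),
  hence flat — excluded by `R ≢ 0`, so the bound holds vacuously-or-by-model-data.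
* `threeShrinkerGap_of_noncompact_scalarCurvature_pos` — **THE REDUCTION**: `ThreeShrinkerGap`
  follows from its own special case for NON-COMPACT solitons with `R > 0` EVERYWHERE. This residual
  is exactly the open half of the classification (Chen 2009 Cor. 2.4 `Ric ≥ 0`; the exclusion of
  the non-compact `Ric > 0` case, Perelman / Naber / Ni–Wallach / Munteanu–Wang 2017; and the
  weighted volume of the quotients of the round cylinder in the degenerate case, whose scalar part
  `S ≡ 1` is `DegenerateShrinker.scalarCurvature_eq_one_of_degenerate` in the tree).
* `threeShrinkerGap_of_classification` — the item typed LITERALLY as the route declaration,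
  conditional on the named fact `threeShrinkerClassification_modelData` (Munteanu–Wang 2016,
  Thm. 1.2): the one-line closing once `threeShrinkerClassification_modelData_holds` lands.

## References

* O. Munteanu, J. Wang, *Structure at infinity for shrinking Ricci solitons*, arXiv:1606.01861,
  Thm. 1.2 (p. 3); proof of Thm. 5.1 (p. 21). [MunteanuWang2016]
* H.-D. Cao, B.-L. Chen, X.-P. Zhu, Surveys in Differential Geometry XII (2008), Prop. 4.7 (p. 78),
  Lemma 4.6 (p. 77). [CaoChenZhu2007]
* Z.-H. Zhang, Proc. AMS 137 (2009), Thm. 1.3 (ii). [Zhang2009]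
* M. Eminenti, G. La Nave, C. Mantegazza, manuscripta math. 127 (2008), §3. [EminentiLanaveMantegazza2008]
* H.-D. Cao, R. S. Hamilton, T. Ilmanen, arXiv:math/0404165 (2004), §3. [CaoHamiltonIlmanen2004]
-/

noncomputable section

-- the prescribed namespace `Summit.<Summit>.<Problem>.…` repeats `SmoothPoincare4` (summit = problem)
set_option linter.dupNamespace false

namespace Summit.SmoothPoincare4.SmoothPoincare4.Theorems.ThreeShrinkerGap

open scoped Manifold ContDiff ENNReal NNReal
open MeasureTheory Set
open Literature.Geometry.Lorentzian Literature.Geometry.Riemannian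
open Summit.SmoothPoincare4.SmoothPoincare4.Theorems.NoncompactShrinkerGapThreeShrinkerGap

variable {N : Type} [TopologicalSpace N] [T2Space N]
  [ChartedSpace (EuclideanSpace ℝ (Fin 3)) N] [IsManifold (𝓡 3) ∞ N]
  [T3Space N] [MeasurableSpace N] [BorelSpace N]
  (h : PseudoRiemannianMetric (𝓡 3) ∞ (EuclideanSpace ℝ (Fin 3)) (TangentSpace (𝓡 3) : N → Type _))
  [h.HasLeviCivita] (hh : h.IsRiemannian) (φ : N → ℝ)

/-! ## One soliton: model data and non-flatness give the bound -/

omit [T2Space N] in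
/-- **Model data ⇒ the gap, for one soliton.** If `(N, h, φ)` satisfies the four-way conclusion of
the classification `threeShrinkerClassification_modelData` — (o) `R ≡ 0` (Gaussian), (a) `φ ≡ 3/2`
and `Vol = 16π²/k` (`S³(2)/Γ`), (b) `∫ e^{-φ} = 16π√π e^{-1}` (cylinder), (c) half of that (its
`ℤ₂`-quotients) — and `R ≢ 0`, then `∫_N e^{-φ} dV_h ≤ 16π² e^{-3/2}`: (o) is excluded, (a) is
`e^{-3/2} · 16π²/k ≤ 16π² e^{-3/2}`, (b), (c) are `e ≤ π`
(`cylinderThreeWeightedVolume_le_sphereThreeWeightedVolume`). The case analysis of p87530, for a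
single soliton instead of the universally quantified fact.
[cite: MunteanuWang2016, proof of Thm 5.1 (p. 21)] [cite: CaoHamiltonIlmanen2004, §3] -/
theorem weightedVolume_le_of_modelData
    (hmodel :
      ((∀ x : N, h.scalarCurvature x = 0) ∧
          ∫⁻ x, ENNReal.ofReal (Real.exp (-φ x))
              ∂(riemannianMeasure (h.toContMDiffRiemannianMetric hh)) =
            ENNReal.ofReal (8 * Real.pi * Real.sqrt Real.pi)) ∨
        (CompactSpace N ∧ (∀ x : N, h.scalarCurvature x = 3 / 2) ∧ (∀ x : N, φ x = 3 / 2) ∧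
          ∃ k : ℕ, 0 < k ∧
            riemannianMeasure (h.toContMDiffRiemannianMetric hh) Set.univ =
              ENNReal.ofReal (16 * Real.pi ^ 2 / k)) ∨
        ((∀ x : N, h.scalarCurvature x = 1) ∧
          ∫⁻ x, ENNReal.ofReal (Real.exp (-φ x))
              ∂(riemannianMeasure (h.toContMDiffRiemannianMetric hh)) =
            ENNReal.ofReal (16 * Real.pi * Real.sqrt Real.pi * Real.exp (-1))) ∨
        ((∀ x : N, h.scalarCurvature x = 1) ∧
          ∫⁻ x, ENNReal.ofReal (Real.exp (-φ x))
              ∂(riemannianMeasure (h.toContMDiffRiemannianMetric hh)) =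
            ENNReal.ofReal (8 * Real.pi * Real.sqrt Real.pi * Real.exp (-1))))
    (hnf : ∃ x : N, h.scalarCurvature x ≠ 0) :
    ∫⁻ x, ENNReal.ofReal (Real.exp (-φ x)) ∂(riemannianMeasure (h.toContMDiffRiemannianMetric hh)) ≤
      ENNReal.ofReal (16 * Real.pi ^ 2 * Real.exp (-(3 : ℝ) / 2)) := by
  rcases hmodel with ⟨hflat, -⟩ | ⟨-, -, hconst, k, hk, hvol⟩ | ⟨-, hcyl⟩ | ⟨-, hhalf⟩
  · -- (o) the Gaussian soliton is flat, excluded by `R ≢ 0`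
    obtain ⟨x, hx⟩ := hnf
    exact absurd (hflat x) hx
  · -- (a) `S³(2)/Γ`: `φ ≡ 3/2`, `Vol = 16π²/k`
    have h32 : ∀ x : N, ENNReal.ofReal (Real.exp (-φ x)) =
        ENNReal.ofReal (Real.exp (-(3 : ℝ) / 2)) := by
      intro x
      rw [hconst x, neg_div]
    rw [lintegral_congr h32, lintegral_const, hvol, ← ENNReal.ofReal_mul (Real.exp_pos _).le]
    exact ENNReal.ofReal_le_ofReal (sphereQuotientThreeWeightedVolume_le hk)
  · -- (b) the cylinder `S²(√2) × ℝ`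
    rw [hcyl]
    exact ENNReal.ofReal_le_ofReal cylinderThreeWeightedVolume_le_sphereThreeWeightedVolume
  · -- (c) its `ℤ₂`-quotients
    rw [hhalf]
    exact ENNReal.ofReal_le_ofReal halfCylinderThreeWeightedVolume_le_sphereThreeWeightedVolume

/-! ## The compact case is a theorem of the tree -/

/-- **The compact case of `ThreeShrinkerGap`, unconditionally.** A compact connected non-flat
normalised three-dimensional gradient shrinking soliton has `∫ e^{-φ} dV ≤ 16π² e^{-3/2}`: by the
compact half of the classification landed in the tree (`ThreeShrinker.modelData_of_compactSpace`:
Ivey's theorem via Eminenti–La Nave–Mantegazza's minimum-point analysis, Schur, and the volume of the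
round space forms `S³(2)/Γ`) and `weightedVolume_le_of_modelData`. Completeness is automatic and not
assumed. [cite: EminentiLanaveMantegazza2008, §3 (pp. 7–8), Prop. 3.7] [cite: Ivey1993, Thm 1] -/
theorem weightedVolume_le_of_compactSpace [CompactSpace N] [ConnectedSpace N]
    (hφ : ContMDiff (𝓡 3) 𝓘(ℝ, ℝ) ∞ φ)
    (hsol : ∀ (x : N) (X Y : TangentSpace (𝓡 3) x),
      h.ricci x X Y + h.hessian φ x X Y = (1 / 2 : ℝ) * h.val x X Y)
    (hnorm : ∀ x : N, h.scalarCurvature x + h.gradSq φ x = φ x)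
    (hnf : ∃ x : N, h.scalarCurvature x ≠ 0) :
    ∫⁻ x, ENNReal.ofReal (Real.exp (-φ x)) ∂(riemannianMeasure (h.toContMDiffRiemannianMetric hh)) ≤
      ENNReal.ofReal (16 * Real.pi ^ 2 * Real.exp (-(3 : ℝ) / 2)) :=
  weightedVolume_le_of_modelData h hh φ
    (ThreeShrinker.modelData_of_compactSpace N h hh φ hφ hsol hnorm) hnf

/-! ## A zero of the scalar curvature: the Gaussian soliton, excluded -/

/-- **A complete member with a point of non-positive scalar curvature satisfies the bound** (in
fact it cannot be non-flat): by Zhang–Chen `R ≥ 0` (`shrinkerScalarCurvature_nonneg_holds`,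
discharged in the tree) such a point is a zero of `R`, so by E. Hopf's minimum principle and
Hamilton's identity the soliton is the flat Gaussian soliton
(`ThreeShrinker.scalarCurvature_pos_or_modelData_of_shrinkerScalarCurvature_nonneg`), whose model
data `weightedVolume_le_of_modelData` turns — with `R ≢ 0` — into the bound.
[cite: Zhang2009, Thm. 1.3 (ii)] [cite: MunteanuWang2016, Thm 1.2 (p. 3), §2 (p. 6)] -/
theorem weightedVolume_le_of_exists_scalarCurvature_nonpos [SecondCountableTopology N]
    [ConnectedSpace N]
    (hcpl : ∀ (x : N) (r : ℝ≥0), IsCompact {y : N | h.edist hh x y ≤ r})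
    (hφ : ContMDiff (𝓡 3) 𝓘(ℝ, ℝ) ∞ φ)
    (hsol : ∀ (x : N) (X Y : TangentSpace (𝓡 3) x),
      h.ricci x X Y + h.hessian φ x X Y = (1 / 2 : ℝ) * h.val x X Y)
    (hnorm : ∀ x : N, h.scalarCurvature x + h.gradSq φ x = φ x)
    (hnf : ∃ x : N, h.scalarCurvature x ≠ 0) (hz : ∃ x : N, h.scalarCurvature x ≤ 0) :
    ∫⁻ x, ENNReal.ofReal (Real.exp (-φ x)) ∂(riemannianMeasure (h.toContMDiffRiemannianMetric hh)) ≤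
      ENNReal.ofReal (16 * Real.pi ^ 2 * Real.exp (-(3 : ℝ) / 2)) := by
  rcases ThreeShrinker.scalarCurvature_pos_or_modelData_of_shrinkerScalarCurvature_nonneg
      shrinkerScalarCurvature_nonneg_holds N h φ hh hcpl hφ hsol hnorm with hpos | hmodel
  · obtain ⟨x, hx⟩ := hz
    exact absurd (hpos x) (not_lt.mpr hx)
  · exact weightedVolume_le_of_modelData h hh φ hmodel hnf

/-! ## The reduction of the item to the non-compact solitons of positive scalar curvature -/

/-- **`ThreeShrinkerGap` reduced to its non-compact, `R > 0` special case.** If every complete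
connected NON-COMPACT normalised three-dimensional gradient shrinking Ricci soliton with `R > 0`
EVERYWHERE has `∫ e^{-φ} dV ≤ 16π² e^{-3/2}`, then `ThreeShrinkerGap` holds: the compact case is
`weightedVolume_le_of_compactSpace`, and a non-compact member with a zero of `R` (`R ≥ 0` by
Zhang–Chen) is the Gaussian soliton, excluded by non-flatness
(`weightedVolume_le_of_exists_scalarCurvature_nonpos`). The hypothesis is the open half of the
classification of three-dimensional shrinkers (Munteanu–Wang 2016, Thm. 1.2: such a soliton is
`S²(√2) × ℝ` or one of its `ℤ₂`-quotients, weighted volume `16π√π e^{-1}` or `8π√π e^{-1}`), i.e. of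
the named fact `threeShrinkerClassification_modelData`.
[cite: MunteanuWang2016, Thm 1.2 (p. 3); proof of Thm 5.1 (p. 21)] [cite: CaoChenZhu2007, Prop 4.7 (p. 78)] -/
theorem threeShrinkerGap_of_noncompact_scalarCurvature_pos
    (hres : ∀ (N : Type) [TopologicalSpace N] [T2Space N] [SecondCountableTopology N]
      [ChartedSpace (EuclideanSpace ℝ (Fin 3)) N] [IsManifold (𝓡 3) ∞ N] [ConnectedSpace N]
      [NoncompactSpace N] [T3Space N] [MeasurableSpace N] [BorelSpace N]
      (h : PseudoRiemannianMetric (𝓡 3) ∞ (EuclideanSpace ℝ (Fin 3)) (TangentSpace (𝓡 3) : N → Type _))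
      [h.HasLeviCivita] (φ : N → ℝ) (hh : h.IsRiemannian),
      (∀ (x : N) (r : ℝ≥0), IsCompact {y : N | h.edist hh x y ≤ r}) →
      ContMDiff (𝓡 3) 𝓘(ℝ, ℝ) ∞ φ →
      (∀ (x : N) (X Y : TangentSpace (𝓡 3) x),
        h.ricci x X Y + h.hessian φ x X Y = (1 / 2 : ℝ) * h.val x X Y) →
      (∀ x : N, h.scalarCurvature x + h.gradSq φ x = φ x) →
      (∀ x : N, 0 < h.scalarCurvature x) →
      ∫⁻ x, ENNReal.ofReal (Real.exp (-φ x)) ∂(riemannianMeasure (h.toContMDiffRiemannianMetric hh)) ≤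
        ENNReal.ofReal (16 * Real.pi ^ 2 * Real.exp (-(3 : ℝ) / 2))) :
    Summit.SmoothPoincare4.SmoothPoincare4.Theses.EntropyRung.ThreeShrinkerGap := by
  unfold Summit.SmoothPoincare4.SmoothPoincare4.Theses.EntropyRung.ThreeShrinkerGap
  intro N _ _ _ _ _ _ _ _ _ h _ φ hh hcpl hφ hsol hnorm hnf
  by_cases hc : CompactSpace N
  · exact weightedVolume_le_of_compactSpace h hh φ hφ hsol hnorm hnf
  · haveI : NoncompactSpace N := not_compactSpace_iff.mp hc
    by_cases hz : ∃ x : N, h.scalarCurvature x ≤ 0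
    · exact weightedVolume_le_of_exists_scalarCurvature_nonpos h hh φ hcpl hφ hsol hnorm hnf hz
    · push Not at hz
      exact hres N h φ hh hcpl hφ hsol hnorm hz

/-! ## The item, closed modulo the classification -/

/-- **`ThreeShrinkerGap` from the classification of three-dimensional shrinkers** (the named fact
`Literature.Geometry.Riemannian.threeShrinkerClassification_modelData`, Munteanu–Wang 2016,
Thm. 1.2; CONDITIONAL on it): typed literally as the route declaration, so that the item closes by
`threeShrinkerGap_of_classification threeShrinkerClassification_modelData_holds` the moment that
`_holds` theorem lands. Proof: p87530's `threeShrinkerGap_of_classification`.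
[cite: MunteanuWang2016, Thm 1.2 (p. 3); proof of Thm 5.1 (p. 21)] -/
theorem threeShrinkerGap_of_classification
    (hcl : Literature.Geometry.Riemannian.threeShrinkerClassification_modelData) :
    Summit.SmoothPoincare4.SmoothPoincare4.Theses.EntropyRung.ThreeShrinkerGap := by
  unfold Summit.SmoothPoincare4.SmoothPoincare4.Theses.EntropyRung.ThreeShrinkerGap
  exact NoncompactShrinkerGapThreeShrinkerGap.threeShrinkerGap_of_classification hcl

/-! ## The item, closed (lead c13 of the crux line `collapsed-ends-usc`, 2026-08-17) -/

/-- **`EntropyRung.ThreeShrinkerGap` (stmt-SmoothPoincare4-16586) — PROVED**: every complete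
connected non-flat normalised three-dimensional gradient shrinking Ricci soliton has
`∫ e^{-φ} dV ≤ 16π² e^{-3/2}`. The classification fact is now a theorem of the tree,
`Literature.Geometry.Riemannian.threeShrinkerClassification_modelData_holds`
(`ThreeShrinkerClassificationHolds.lean`: (F1) `Ric ≥ 0` by the elliptic Hamilton–Ivey maximum
principle, (F2) Munteanu–Wang 2017 Thm. 2 by the elliptic barrier for `Ric`, the logarithmic growth
of `R`, finite volume, and Calabi–Yau's infinite-volume theorem `ricciNonneg_infiniteVolume_holds`),
so the item closes by the announced one-liner.
[cite: MunteanuWang2016, Thm 1.2 (p. 3)] [cite: MunteanuWang2017, Thm. 2] -/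
theorem threeShrinkerGap_proof :
    Summit.SmoothPoincare4.SmoothPoincare4.Theses.EntropyRung.ThreeShrinkerGap :=
  threeShrinkerGap_of_classification
    Literature.Geometry.Riemannian.threeShrinkerClassification_modelData_holds

end Summit.SmoothPoincare4.SmoothPoincare4.Theorems.ThreeShrinkerGap

end
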